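import Summits.BirchSwinnertonDyer.Rank1Residual.P2.CubeSumLocalTypes
import Literature.NumberTheory.EllipticCurves.NeronComponentIndexTypeIIIstarProofs
import Literature.NumberTheory.EllipticCurves.NeronComponentIndexTypeIVProofs
import Literature.NumberTheory.EllipticCurves.NeronComponentIndexTypeIVstarProofs
import HarnessLib

/-!
# Route `CMKolyvaginAtInertTwo` (leaf `WAllCornerFTwo`): the TAMAGAWA binder of the habitat `H₂` on
# the cube-sum family — `∏_ℓ c_ℓ(E_n)` is ODD iff `n ≢ ±2 (mod 9)` (`n` cube-free), PROVED

Cell `bsd-print-cf2` (run/shared/lean/pub/bsd-print-cf2/), seat ty2 (discharge interface), line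
`route-BirchSwinnertonDyer-CMKolyvaginAtInertTwo` (items stmt-BirchSwinnertonDyer-22835/22836,
residual 22838). HONEST FRAMING: THEOREMS ONLY — no definition, no named fact, no route file imported,
nothing about BSD asserted or booked; the leaf `Summit.BirchSwinnertonDyer.WAllCornerFTwo` is OPEN.
The habitat `H₂` of the line carries the binder `Odd W.tamagawaProduct`; this file DECIDES it, in the
kernel, for every globally minimal (indeed every) model `W` of every cube-sum curve
`E_n : x³ + y³ = n`, `n` cube-free: **`Odd (∏_ℓ c_ℓ) ⟺ n ≢ ±2 (mod 9)`**
(`odd_tamagawaProduct_of_model_iff`). Mechanism (`CubeSumLocalTypes{AtThree}.lean` +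
`NeronComponentIndex*Proofs`): at every place `ℓ ≠ 3` the curve is good or of type IV / IV*
(`c_ℓ ∈ {1, 3}`), and at `3` it is `III*` (`c₃ = 2`) exactly when `n ≡ ±2 (mod 9)`, else
`IV*`/`II*`/`II` (`c₃ ∈ {1, 3}`). So the Sylvester primes `p ≡ 4, 8 (mod 9)` (and `2p`, `p²`, …
with `n ≢ ±2`) meet the Tamagawa binder, while `n ≡ ±2 (mod 9)` (e.g. `p ≡ 2, 7`) is OFF the
habitat through `c₃ = 2` — the census line of DOSSIER §20 (lit g9, kit j291250: "OUT ⟺ n ≡ ±2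
(mod 9) ⟺ c₃ = 2") as a theorem. Numerical cross-check (EVIDENCE, not used): kit j293806 (PARI
`elltamagawa`, cube-free `n ≤ 400`).

## What is here

* §1 (any `W/ℚ`, any place `v`) parity of `c_v` from the Kodaira symbol: odd for good / II / IV /
  IV* / II*, `= 2` for III* — the tree's discharged facts `localTamagawaNumber_*_holds`.
* §2 `Odd W.tamagawaProduct ↔ ∀ v, Odd c_v` (finite support, `mulSupport_localTamagawaNumber_finite_holds`).
* §3 the cube-sum family: `c_v` odd at every `v ∤ 3`; at `v ∣ 3`: `c_v = 2` iff `n ≡ ±2 (mod 9)`,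
  odd otherwise; the assembly `odd_tamagawaProduct_of_model_iff` and its two directions.

References: J. H. Silverman, *ATAEC* IV.9.4 and Table 4.1 [SilvermanATAEC1994]; O. G. Rizzo,
Compositio Math. 136 (2003) Table II [Rizzo2003]; Hu–Shu–Yin 2019 p. 4 [HuShuYin2019].
-/

set_option autoImplicit false

noncomputable section

open scoped Classical NumberField

open WeierstrassCurve NumberField IsDedekindDomain IsDedekindDomain.HeightOneSpectrum
  Rat.HeightOneSpectrum Literature.NumberTheory.EllipticCurves
  Literature.NumberTheory.EllipticCurves.HuShuYin2019
  Literature.NumberTheory.DiophantineGeometry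

namespace Summit.BirchSwinnertonDyer.Rank1Residual.P2.CubeSum

/-! ## §1 The parity of `c_v` from the Kodaira symbol (any curve over `ℚ`, any place) -/

section Local

variable (W : WeierstrassCurve ℚ) [W.IsElliptic] (v : HeightOneSpectrum (𝓞 ℚ))

omit [W.IsElliptic] in
/-- `c_v = 1` at a place of good reduction; in particular `c_v` is odd. [cite: SilvermanAEC2009, VII.2 (remark after Prop. 2.1)] -/
theorem odd_localTamagawaNumber_of_hasGoodReductionAt (h : W.HasGoodReductionAt v) :
    Odd ((W.baseChange (v.adicCompletion ℚ)).localTamagawaNumber (v.adicCompletionIntegers ℚ)) := by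
  rw [W.localTamagawaNumber_eq_one_of_hasGoodReductionAt_holds v h]; exact odd_one

/-- Type `II`: `c_v = 1`, odd. [cite: SilvermanATAEC1994, IV.9.4 Step 3 (PDF p. 344)] -/
theorem odd_localTamagawaNumber_of_kodairaSymbolAt_eq_II (h : W.kodairaSymbolAt v = .II) :
    Odd ((W.baseChange (v.adicCompletion ℚ)).localTamagawaNumber (v.adicCompletionIntegers ℚ)) := by
  haveI : PerfectField (IsLocalRing.ResidueField (v.adicCompletionIntegers ℚ)) := PerfectField.ofFinite
  rw [localTamagawaNumber_eq_one_of_kodairaSymbolAt_eq_II_holds v W h]; exact odd_one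

/-- Type `II*`: `c_v = 1`, odd. [cite: SilvermanATAEC1994, IV.9.4 Step 10 (PDF p. 346)] -/
theorem odd_localTamagawaNumber_of_kodairaSymbolAt_eq_IIstar (h : W.kodairaSymbolAt v = .IIstar) :
    Odd ((W.baseChange (v.adicCompletion ℚ)).localTamagawaNumber (v.adicCompletionIntegers ℚ)) := by
  haveI : PerfectField (IsLocalRing.ResidueField (v.adicCompletionIntegers ℚ)) := PerfectField.ofFinite
  rw [localTamagawaNumber_eq_one_of_kodairaSymbolAt_eq_IIstar_holds v W h]; exact odd_one

/-- Type `IV`: `c_v ∈ {1, 3}`, odd. [cite: SilvermanATAEC1994, IV.9.4 Step 5 (PDF p. 344)] -/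
theorem odd_localTamagawaNumber_of_kodairaSymbolAt_eq_IV (h : W.kodairaSymbolAt v = .IV) :
    Odd ((W.baseChange (v.adicCompletion ℚ)).localTamagawaNumber (v.adicCompletionIntegers ℚ)) := by
  haveI : PerfectField (IsLocalRing.ResidueField (v.adicCompletionIntegers ℚ)) := PerfectField.ofFinite
  rcases localTamagawaNumber_of_kodairaSymbolAt_eq_IV_holds v W h with h1 | h3
  · rw [h1]; exact odd_one
  · rw [h3]; exact ⟨1, rfl⟩

/-- Type `IV*`: `c_v ∈ {1, 3}`, odd. [cite: SilvermanATAEC1994, IV.9.4 Step 8 (PDF p. 345)] -/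
theorem odd_localTamagawaNumber_of_kodairaSymbolAt_eq_IVstar (h : W.kodairaSymbolAt v = .IVstar) :
    Odd ((W.baseChange (v.adicCompletion ℚ)).localTamagawaNumber (v.adicCompletionIntegers ℚ)) := by
  haveI : PerfectField (IsLocalRing.ResidueField (v.adicCompletionIntegers ℚ)) := PerfectField.ofFinite
  rcases localTamagawaNumber_of_kodairaSymbolAt_eq_IVstar_holds v W h with h1 | h3
  · rw [h1]; exact odd_one
  · rw [h3]; exact ⟨1, rfl⟩

/-- Type `III*`: `c_v = 2`. [cite: SilvermanATAEC1994, IV.9.4 Step 9 (PDF p. 346)] -/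
theorem localTamagawaNumber_eq_two_of_kodairaSymbolAt_eq_IIIstar (h : W.kodairaSymbolAt v = .IIIstar) :
    (W.baseChange (v.adicCompletion ℚ)).localTamagawaNumber (v.adicCompletionIntegers ℚ) = 2 := by
  haveI : PerfectField (IsLocalRing.ResidueField (v.adicCompletionIntegers ℚ)) := PerfectField.ofFinite
  exact localTamagawaNumber_eq_two_of_kodairaSymbolAt_eq_IIIstar_holds v W h

/-- Good, or type `IV`, or type `IV*`: `c_v` is odd. [cite: SilvermanATAEC1994, IV.9.4 and Table 4.1] -/
theorem odd_localTamagawaNumber_of_good_or_IV_or_IVstar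
    (h : W.HasGoodReductionAt v ∨ W.kodairaSymbolAt v = .IV ∨ W.kodairaSymbolAt v = .IVstar) :
    Odd ((W.baseChange (v.adicCompletion ℚ)).localTamagawaNumber (v.adicCompletionIntegers ℚ)) := by
  rcases h with h | h | h
  · exact odd_localTamagawaNumber_of_hasGoodReductionAt W v h
  · exact odd_localTamagawaNumber_of_kodairaSymbolAt_eq_IV W v h
  · exact odd_localTamagawaNumber_of_kodairaSymbolAt_eq_IVstar W v h

end Local

/-! ## §2 `∏ c_v` is odd iff every `c_v` is odd -/

section Global

/-- A finite product of natural numbers is odd iff every factor is odd. [folklore] -/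
theorem odd_finprod_iff {ι : Type*} (f : ι → ℕ) (hf : (Function.mulSupport f).Finite) :
    Odd (∏ᶠ i, f i) ↔ ∀ i, Odd (f i) := by
  rw [finprod_eq_prod f hf]
  constructor
  · intro h i
    by_cases hi : i ∈ hf.toFinset
    · by_contra hodd
      have h2 : 2 ∣ f i := even_iff_two_dvd.mp (Nat.not_odd_iff_even.mp hodd)
      exact (Nat.not_even_iff_odd.mpr h) (even_iff_two_dvd.mpr (h2.trans (Finset.dvd_prod_of_mem f hi)))
    · rw [Set.Finite.mem_toFinset, Function.mem_mulSupport, not_not] at hi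
      rw [hi]; exact odd_one
  · intro h
    exact Finset.prod_induction f Odd (fun a b ha hb => ha.mul hb) odd_one fun i _ => h i

variable (W : WeierstrassCurve ℚ) [W.IsElliptic]

/-- **`Odd (∏_v c_v) ⟺ ∀ v, Odd c_v`** for an elliptic curve over `ℚ` (`c_v = 1` off the finitely many
bad places). [cite: SilvermanAEC2009, Prop. VII.5.1 (a) with §VII.2] -/
theorem odd_tamagawaProduct_iff :
    Odd W.tamagawaProduct ↔
      ∀ v : HeightOneSpectrum (𝓞 ℚ),
        Odd ((W.baseChange (v.adicCompletion ℚ)).localTamagawaNumber (v.adicCompletionIntegers ℚ)) :=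
  odd_finprod_iff _ W.mulSupport_localTamagawaNumber_finite_holds

end Global

/-! ## §3 The cube-sum family: `∏_ℓ c_ℓ(E_n)` is odd iff `n ≢ ±2 (mod 9)` -/

section CubeSum

variable {n : ℤ} (B : WeierstrassCurve ℚ) [B.IsElliptic]

/-- The prime under a place of `ℚ` is `2`, `3`, or `≥ 5`. [folklore] -/
theorem natGenerator_cases (v : HeightOneSpectrum (𝓞 ℚ)) :
    natGenerator v = 2 ∨ natGenerator v = 3 ∨ 5 ≤ natGenerator v := by
  have hp := prime_natGenerator v
  by_cases h2 : natGenerator v = 2; · exact Or.inl h2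
  by_cases h3 : natGenerator v = 3; · exact Or.inr (Or.inl h3)
  refine Or.inr (Or.inr ?_)
  have h2' := hp.two_le
  have h4 : natGenerator v ≠ 4 := fun h => by rw [h] at hp; exact absurd hp (by decide)
  omega

/-- **`c_v(E_n)` is odd at every place `v ∤ 3`** (`n` cube-free, every model): good or type IV / IV*
there. [cite: SilvermanATAEC1994, IV.9.4 and Table 4.1] -/
theorem odd_localTamagawaNumber_of_model_of_ne_three (hn : n ≠ 0)
    (hcf : ∀ p : ℕ, p.Prime → ¬ (p : ℤ) ^ 3 ∣ n)
    (hB : ∃ C : VariableChange ℚ, C • B = cubeSumCurve (n : ℚ))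
    (v : HeightOneSpectrum (𝓞 ℚ)) (hv : natGenerator v ≠ 3) :
    Odd ((B.baseChange (v.adicCompletion ℚ)).localTamagawaNumber (v.adicCompletionIntegers ℚ)) := by
  rcases natGenerator_cases v with h2 | h3 | h5
  · exact odd_localTamagawaNumber_of_good_or_IV_or_IVstar B v
      (hasGoodReductionAt_or_kodairaSymbolAt_two_of_model_of_cubefree B v hcf hB h2)
  · exact absurd h3 hv
  · exact odd_localTamagawaNumber_of_good_or_IV_or_IVstar B v
      (hasGoodReductionAt_or_kodairaSymbolAt_of_model_of_cubefree B v hn hcf hB h5)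

/-- **`c₃(E_n) = 2` for `n ≡ ±2 (mod 9)`** (type III*; every model). [cite: Rizzo2003, Table II (p. 4)]
[cite: SilvermanATAEC1994, IV.9.4 Step 9] -/
theorem localTamagawaNumber_three_of_model_eq_two (hn : n ≠ 0)
    (hcf : ∀ p : ℕ, p.Prime → ¬ (p : ℤ) ^ 3 ∣ n)
    (hB : ∃ C : VariableChange ℚ, C • B = cubeSumCurve (n : ℚ))
    (v : HeightOneSpectrum (𝓞 ℚ)) (hv : natGenerator v = 3) (h9 : n % 9 = 2 ∨ n % 9 = 7) :
    (B.baseChange (v.adicCompletion ℚ)).localTamagawaNumber (v.adicCompletionIntegers ℚ) = 2 :=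
  localTamagawaNumber_eq_two_of_kodairaSymbolAt_eq_IIIstar B v
    (by rw [kodairaSymbolAt_three_of_model hn hcf B hB v hv, if_pos h9])

/-- **`c₃(E_n)` is odd for `n ≢ ±2 (mod 9)`** (type IV*, II* or II; every model).
[cite: Rizzo2003, Table II (p. 4)] [cite: SilvermanATAEC1994, IV.9.4 and Table 4.1] -/
theorem odd_localTamagawaNumber_three_of_model (hn : n ≠ 0)
    (hcf : ∀ p : ℕ, p.Prime → ¬ (p : ℤ) ^ 3 ∣ n)
    (hB : ∃ C : VariableChange ℚ, C • B = cubeSumCurve (n : ℚ))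
    (v : HeightOneSpectrum (𝓞 ℚ)) (hv : natGenerator v = 3) (h9 : ¬ (n % 9 = 2 ∨ n % 9 = 7)) :
    Odd ((B.baseChange (v.adicCompletion ℚ)).localTamagawaNumber (v.adicCompletionIntegers ℚ)) := by
  have hk := kodairaSymbolAt_three_of_model hn hcf B hB v hv
  rw [if_neg h9] at hk
  by_cases h36 : n % 9 = 3 ∨ n % 9 = 6
  · rw [if_pos h36] at hk
    exact odd_localTamagawaNumber_of_kodairaSymbolAt_eq_IIstar B v hk
  rw [if_neg h36] at hk
  by_cases h0 : n % 9 = 0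
  · rw [if_pos h0] at hk
    exact odd_localTamagawaNumber_of_kodairaSymbolAt_eq_II B v hk
  · rw [if_neg h0] at hk
    exact odd_localTamagawaNumber_of_kodairaSymbolAt_eq_IVstar B v hk

/-- **THE TAMAGAWA BINDER ON THE CUBE-SUM FAMILY.** For `n ∈ ℤ` cube-free, `n ≠ 0`, and EVERY model
`B` of `E_n : x³ + y³ = n` (`∃ C, C • B = (y² = x³ − 432n²)`):
`Odd (∏_ℓ c_ℓ(B)) ⟺ n ≢ ±2 (mod 9)`. [cite: SilvermanATAEC1994, IV.9.4 and Table 4.1]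
[cite: Rizzo2003, Table II (p. 4)] -/
theorem odd_tamagawaProduct_of_model_iff (hn : n ≠ 0)
    (hcf : ∀ p : ℕ, p.Prime → ¬ (p : ℤ) ^ 3 ∣ n)
    (hB : ∃ C : VariableChange ℚ, C • B = cubeSumCurve (n : ℚ)) :
    Odd B.tamagawaProduct ↔ ¬ (n % 9 = 2 ∨ n % 9 = 7) := by
  rw [odd_tamagawaProduct_iff B]
  constructor
  · intro h h9
    set v₃ : HeightOneSpectrum (𝓞 ℚ) := (primesEquiv (R := 𝓞 ℚ)).symm ⟨3, Nat.prime_three⟩ with hv₃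
    have hv : natGenerator v₃ = 3 := by
      show ((primesEquiv v₃ : Nat.Primes) : ℕ) = 3
      rw [hv₃, Equiv.apply_symm_apply]
    have h2 := localTamagawaNumber_three_of_model_eq_two B hn hcf hB v₃ hv h9
    have := h v₃
    rw [h2] at this
    exact (Nat.not_even_iff_odd.mpr this) (by decide)
  · intro h9 v
    by_cases hv : natGenerator v = 3
    · exact odd_localTamagawaNumber_three_of_model B hn hcf hB v hv h9
    · exact odd_localTamagawaNumber_of_model_of_ne_three B hn hcf hB v hv

/-- The habitat's binder MET: `n ≢ ±2 (mod 9)` ⟹ `Odd (∏_ℓ c_ℓ)` for every model of `E_n`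
(e.g. the Sylvester primes `p ≡ 4, 8 (mod 9)`, and `2p`, `p²` with `n ≢ ±2`).
[cite: SilvermanATAEC1994, IV.9.4 and Table 4.1] [cite: Rizzo2003, Table II (p. 4)] -/
theorem odd_tamagawaProduct_of_model (hn : n ≠ 0)
    (hcf : ∀ p : ℕ, p.Prime → ¬ (p : ℤ) ^ 3 ∣ n)
    (hB : ∃ C : VariableChange ℚ, C • B = cubeSumCurve (n : ℚ)) (h9 : ¬ (n % 9 = 2 ∨ n % 9 = 7)) :
    Odd B.tamagawaProduct :=
  (odd_tamagawaProduct_of_model_iff B hn hcf hB).mpr h9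

/-- The habitat's binder FAILS: `n ≡ ±2 (mod 9)` ⟹ `∏_ℓ c_ℓ` is EVEN for every model of `E_n`
(`c₃ = 2`; these cube sums — e.g. the primes `p ≡ 2, 7 (mod 9)` — belong to the residual 22838).
[cite: SilvermanATAEC1994, IV.9.4 and Table 4.1] [cite: Rizzo2003, Table II (p. 4)] -/
theorem not_odd_tamagawaProduct_of_model (hn : n ≠ 0)
    (hcf : ∀ p : ℕ, p.Prime → ¬ (p : ℤ) ^ 3 ∣ n)
    (hB : ∃ C : VariableChange ℚ, C • B = cubeSumCurve (n : ℚ)) (h9 : n % 9 = 2 ∨ n % 9 = 7) :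
    ¬ Odd B.tamagawaProduct :=
  fun h => (odd_tamagawaProduct_of_model_iff B hn hcf hB).mp h h9

end CubeSum

end Summit.BirchSwinnertonDyer.Rank1Residual.P2.CubeSum

end
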